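import Summits.QuantumAdvantage.QuantumAdvantage.Theorems.CubicForrelationNearExactIsExactTwelveT1Dead

/-!
# Crux `CubicForrelation.NearExactIsExact` (stmt-QuantumAdvantage-14043) — n = 12, type O with base set `960` AT AND ABOVE `930/1024`: dead
  (the boundary value `Φ = 930/1024`, excess `≤ 256`, included)

Certificate seat `b2b-cforr-cert` (gen 19).  HONEST FRAMING: a kernel-checked lemma (standard axioms) for the type-O branch of the rung `930/1024`
at `n = 12`; NO new value of `θ₁₂` by itself.  NOT summit progress.

`to19_typeO_E960_ge930_false`: cubic `f, g`, `W_g = 16u`, some `u(x)` odd, `#E = 960`, `Φ(f,g) ≥ 930/1024` — impossible.  As in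
`to19_typeO_E960_gt930_false` (`…TwelveTypeO960Above930`): `Σ τ² ≤ 12032`, `Σ v² ≤ 16`, the partner identity gives `v̂ = 8K` with `K ≡ −u_f (mod 4)`
and now `|K| ≤ 2`.  If some `u_f` is odd, `f` is type O, every `K` is odd, `|K| = 1` everywhere and `Σ v² = 64`.  Otherwise every `K` is even,
`K ∈ {0, ±2}`, `u_f` is even and `K(y) = ±2` exactly on the odd set of `k' = u_f/2` — the level-5 digit, whose parity is AFFINE
(`stub_walshTower stub_axParity`), so that set is empty or has `≥ 2048` points (Reed–Muller); `2048·256 > 4096·16` excludes the latter, and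
`K ≡ 0` means `v ≡ 0`, `Φ = 932/1024`, dead (`tw19_isolation_ge_932`).  So at `Φ = 930/1024` a type-O side can only have the base set `992`
(zero excess) — the analogue one level up of the `T1` configuration of `932/1024`.

References: Kasami–Tokura (1970); MacWilliams–Sloane (1977) Ch. 15; O'Donnell (2014) §1.4.  Axioms: the standard three.
-/

set_option linter.dupNamespace false -- D-0017: single-problem summit ⇒ `QuantumAdvantage.QuantumAdvantage` by design

noncomputable section

namespace Summit.QuantumAdvantage.QuantumAdvantage.Theorems.CubicForrelation.NearExactIsExact

open Finset
open Literature.Computability.QuantumComplexity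
open Literature.Computability.QuantumComplexity.BuzetChailloux (bxor zeroVec bxor_bxor_cancel_left bxor_zeroVec zeroVec_bxor bxor_comm
  bxor_self twist_zeroVec_right twist_bxor_right signOf_sq sum_twist_left)
open Literature.Computability.QuantumComplexity.DerivativeWalsh (W sum_W_sq)
open Literature.Computability.QuantumComplexity.Simon (twist_eq_one_or)
open Summit.QuantumAdvantage.QuantumAdvantage.Theorems.NearExactIsExact.Negative (TypeOTwelve.no_caseA TypeOTwelve.cube_sum_dvd
  TypeOTwelve.typeO_of_exists_odd)
open Summit.QuantumAdvantage.QuantumAdvantage.Theorems.SignedCubicForrelationNotPrBPP (knf_isDegLeFun_ip)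

/-! ### The base set `960` above `930/1024` -/

/-- **No type-O side with base set `960` at `Φ ≥ 930/1024`** (12 bits; given the partner's Ax-level data `W_f = 16u_f`).  See the module
docstring.  NOT summit progress. [this work] -/
theorem to19_typeO_E960_ge930_false (f g : (Fin (6 + 6) → Bool) → Bool) (hf : IsDegLeFun 3 f) (hg : IsDegLeFun 3 g)
    (u : (Fin (6 + 6) → Bool) → ℤ) (hu : ∀ x, W (fun y => signOf (g y)) x = (2 : ℝ) ^ 4 * (u x : ℝ))
    (hodd : ∃ x, Odd (u x)) (hE : #(univ.filter fun x : Fin (6 + 6) → Bool => (Odd (u x / 2) ↔ Odd (u x / 2 / 2))) = 960)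
    (hΦ : (930 / 1024 : ℝ) ≤ forrelation f g)
    (uf : (Fin (6 + 6) → Bool) → ℤ) (huf : ∀ y, W (fun x => signOf (f x)) y = (2 : ℝ) ^ 4 * (uf y : ℝ)) : False := by
  classical
  have hall : ∀ x, Odd (u x) := TypeOTwelve.typeO_of_exists_odd g u hg hu hodd
  have hu' : ∀ x, W (fun y => signOf (g y)) x = (2 : ℝ) ^ (2 * 2) * (u x : ℝ) := fun x => (hu x).trans (by norm_num)
  have hd1 : IsDegLeFun 1 (fun x => decide (Odd (u x / 2))) := z2_digitOne 2 g u hg hu' hall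
  have hd2 : IsDegLeFun 3 (fun x => decide (Odd (u x / 2 / 2))) := z2_digitTwo 2 g u hg hu' hall
  obtain ⟨c₁, b₁, hcb⟩ := stub_affineForm (6 + 6) _ hd1
  set E := univ.filter (fun x : Fin (6 + 6) → Bool => (Odd (u x / 2) ↔ Odd (u x / 2 / 2))) with hEdef
  have hdegE : IsDegLeFun (2 + 1) (fun x => (decide (Odd (u x / 2)) ^^ decide (Odd (u x / 2 / 2))) ^^ true) :=
    tb_isDegLeFun_xor_const (bb_isDegLeFun_bxor (hd1.mono (by norm_num)) hd2) true
  have hsetE : (univ.filter fun x : Fin (6 + 6) → Bool =>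
      ((decide (Odd (u x / 2)) ^^ decide (Odd (u x / 2 / 2))) ^^ true) = true) = E := by
    rw [hEdef]
    apply filter_congr
    intro x _
    by_cases h1 : Odd (u x / 2) <;> by_cases h2 : Odd (u x / 2 / 2) <;> simp [h1, h2]
  have hsumE : (∑ x, (if (Odd (u x / 2) ↔ Odd (u x / 2 / 2)) then 1 else 0 : ℤ)) = #E := by rw [sum_boole]
  -- budget and the wild function
  have hbud := tw12_budget f g u hu
  have hT : (∑ x, (u x - 4 * sZ (f x)) ^ 2 : ℤ) ≤ 12032 := by
    have h' : ((∑ x, (u x - 4 * sZ (f x)) ^ 2 : ℤ) : ℝ) ≤ 12032 := by rw [hbud]; linarith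
    exact_mod_cast h'
  choose v hv using fun x => to12_pt_mod8 (u x) (sZ (f x)) (hall x) (tp_sZ_cases (f x))
  set τ₀ : (Fin (6 + 6) → Bool) → ℤ := fun x =>
    sZ (decide (Odd (u x / 2))) * (1 - 4 * (if (Odd (u x / 2) ↔ Odd (u x / 2 / 2)) then 1 else 0)) with hτ₀def
  have hvx : ∀ x, u x - 4 * sZ (f x) = τ₀ x + 8 * v x := fun x => hv x
  have hτ₀val : ∀ x, τ₀ x = 1 ∨ τ₀ x = -1 ∨ τ₀ x = 3 ∨ τ₀ x = -3 := by
    intro x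
    simp only [τ₀]
    rcases tp_sZ_cases (decide (Odd (u x / 2))) with h | h <;> rw [h] <;> split_ifs <;> norm_num
  have hτ₀sq : ∀ x, τ₀ x ^ 2 = 1 + 8 * (if (Odd (u x / 2) ↔ Odd (u x / 2 / 2)) then 1 else 0 : ℤ) := by
    intro x
    simp only [τ₀]
    rcases tp_sZ_cases (decide (Odd (u x / 2))) with h | h <;> rw [h] <;> split_ifs <;> norm_num
  have hsumτ₀ : ∑ x, τ₀ x ^ 2 = 11776 := by
    rw [sum_congr rfl fun x _ => hτ₀sq x, sum_add_distrib, ← mul_sum, hsumE, sum_const, card_univ, Fintype.card_fun,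
      Fintype.card_bool, Fintype.card_fin]
    change (4096 : ℕ) • (1 : ℤ) + 8 * ((#E : ℕ) : ℤ) = 11776
    rw [hE]; norm_num
  -- `X ≥ 16 v²` pointwise, hence `Σ v² ≤ 16`
  have hX16 : ∀ x, 16 * v x ^ 2 ≤ (τ₀ x + 8 * v x) ^ 2 - τ₀ x ^ 2 := by
    intro x
    have hv3 : v x = 0 ∨ 1 ≤ v x ∨ v x ≤ -1 := by omega
    rcases hv3 with h0 | h1 | h1
    · rw [h0]; ring_nf; rfl
    · rcases hτ₀val x with h | h | h | h <;> rw [h] <;> nlinarith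
    · rcases hτ₀val x with h | h | h | h <;> rw [h] <;> nlinarith
  have hTdec : (∑ x, (u x - 4 * sZ (f x)) ^ 2 : ℤ) = ∑ x, τ₀ x ^ 2 + ∑ x, ((τ₀ x + 8 * v x) ^ 2 - τ₀ x ^ 2) := by
    rw [← sum_add_distrib]
    exact sum_congr rfl fun x _ => by rw [hvx x]; ring
  have hv2 : ∑ x, v x ^ 2 ≤ 16 := by
    have h1 : 16 * ∑ x, v x ^ 2 ≤ ∑ x, ((τ₀ x + 8 * v x) ^ 2 - τ₀ x ^ 2) := by rw [mul_sum]; exact sum_le_sum fun x _ => hX16 x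
    rw [hTdec, hsumτ₀] at hT
    linarith
  -- `v ≢ 0` (else `Φ = 932/1024`, dead by `tw19_isolation_ge_932`)
  have hvne : ∃ x, v x ≠ 0 := by
    by_contra hnone
    push Not at hnone
    have hT0 : (∑ x, (u x - 4 * sZ (f x)) ^ 2 : ℤ) = 11776 := by
      rw [hTdec, hsumτ₀, sum_eq_zero fun x _ => by rw [hnone x]; ring]; ring
    have hΦ932 : forrelation f g = 932 / 1024 := by
      have : ((11776 : ℤ) : ℝ) = (2 : ℝ) ^ 17 * (1 - forrelation f g) := by rw [← hT0]; exact hbud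
      norm_num at this; linarith
    have h1 := tw19_isolation_ge_932 f g hf hg (by rw [hΦ932])
    rw [hΦ932] at h1
    norm_num at h1
  -- Parseval for `v`
  set Vh : (Fin (6 + 6) → Bool) → ℝ := fun y => ∑ x, (v x : ℝ) * twist x y with hVh
  have hParsV : ∑ y, Vh y ^ 2 = 4096 * ((∑ x, v x ^ 2 : ℤ) : ℝ) := by
    have h := sum_W_sq (n := 6 + 6) (fun x => (v x : ℝ))
    unfold W at h
    rw [h]; push_cast; norm_num
  -- `|Vh| ≤ 16`
  have hVle : ∀ y, |Vh y| ≤ 16 := by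
    intro y
    have h1 : |Vh y| ≤ ∑ x, |(v x : ℝ)| := by
      calc |Vh y| ≤ ∑ x, |(v x : ℝ) * twist x y| := abs_sum_le_sum_abs _ _
        _ = ∑ x, |(v x : ℝ)| := sum_congr rfl fun x _ => by
            rw [abs_mul]; rcases twist_eq_one_or x y with h | h <;> rw [h] <;> simp
    have h2 : ∑ x, |(v x : ℝ)| ≤ ∑ x, ((v x : ℝ)) ^ 2 := sum_le_sum fun x _ => by
      rw [← sq_abs]
      rcases eq_or_ne (v x) 0 with h | h
      · rw [h]; simp
      · have : (1 : ℝ) ≤ |(v x : ℝ)| := by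
          rw [← Int.cast_abs]; exact_mod_cast Int.one_le_abs h
        nlinarith
    have h3 : ∑ x, ((v x : ℝ)) ^ 2 ≤ 16 := by
      have : ((∑ x, v x ^ 2 : ℤ) : ℝ) ≤ 16 := by exact_mod_cast hv2
      push_cast at this; exact this
    linarith
  -- the partner identity with `Ê ∈ 64ℤ`: `Vh(y) = 8·K(y)`, `K ≡ −u_f (mod 4)` (indeed `K + u_f ∈ 4ℤ`)
  have hK : ∀ y, ∃ K : ℤ, Vh y = 8 * (K : ℝ) ∧ 4 ∣ K + uf y := by
    intro y
    have h := to18_typeO_partner_identity f g u hu v hv c₁ b₁ hcb uf huf y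
    rw [← hEdef] at h
    obtain ⟨m, -, hm⟩ := to18_char_sum_E960 _ hdegE (by rw [hsetE]; exact hE) (bxor c₁ y)
    rw [hsetE] at hm
    rw [hm] at h
    change 64 * (uf y : ℝ) = 256 * signOf (g y) - signOf b₁ * ((if bxor c₁ y = (fun _ => false) then (2 : ℝ) ^ (6 + 6) else 0) -
      4 * (64 * (m : ℝ))) - 8 * Vh y at h
    have hsb : signOf b₁ = 1 ∨ signOf b₁ = -1 := by cases b₁ <;> simp [signOf]
    by_cases hz : bxor c₁ y = (fun _ => false)
    · rw [if_pos hz] at h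
      refine ⟨4 * sZ (g y) - 64 * sZ b₁ + 4 * sZ b₁ * m - uf y, ?_, ⟨sZ (g y) - 16 * sZ b₁ + sZ b₁ * m, by ring⟩⟩
      push_cast; rw [tp_sZ_cast, tp_sZ_cast]
      rcases hsb with hs | hs <;> rw [hs] at h ⊢ <;> norm_num at h ⊢ <;> linarith
    · rw [if_neg hz] at h
      refine ⟨4 * sZ (g y) + 4 * sZ b₁ * m - uf y, ?_, ⟨sZ (g y) + sZ b₁ * m, by ring⟩⟩
      push_cast; rw [tp_sZ_cast, tp_sZ_cast]
      rcases hsb with hs | hs <;> rw [hs] at h ⊢ <;> norm_num at h ⊢ <;> linarith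
  -- `K` as a function: `Vh = 8K`, `4 ∣ K + u_f`, `|K| ≤ 2`
  choose K hK8 hK4 using hK
  have hKle : ∀ y, |K y| ≤ 2 := by
    intro y
    have h := hVle y
    rw [hK8 y, abs_mul, abs_of_pos (by norm_num : (0 : ℝ) < 8)] at h
    have h2 : ((|K y| : ℤ) : ℝ) ≤ 2 := by rw [Int.cast_abs]; linarith
    exact_mod_cast h2
  have hsumK : ∑ y, Vh y ^ 2 = 64 * ∑ y, ((K y : ℝ)) ^ 2 := by
    rw [mul_sum]; exact sum_congr rfl fun y _ => by rw [hK8 y]; ring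
  -- `Σ K² = 64 Σ v² ≤ 1024`
  have hKsum : ∑ y, ((K y : ℝ)) ^ 2 ≤ 1024 := by
    have h3 : ((∑ x, v x ^ 2 : ℤ) : ℝ) ≤ 16 := by exact_mod_cast hv2
    have := hParsV; rw [hsumK] at this; nlinarith
  by_cases hO : ∃ y₀, Odd (uf y₀)
  · /- (1) `f` type O: every `K` is odd, `K² ≥ 1` everywhere ⇒ `Σ K² ≥ 4096` -/
    obtain ⟨y₀, hy₀⟩ := hO
    have hallf : ∀ y, Odd (uf y) := TypeOTwelve.typeO_of_exists_odd f uf hf huf ⟨y₀, hy₀⟩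
    have hK1 : ∀ y, (1 : ℝ) ≤ ((K y : ℝ)) ^ 2 := by
      intro y
      have hKodd : Odd (K y) := by
        have h1 := hallf y
        rw [Int.odd_iff] at h1 ⊢
        obtain ⟨q, hq⟩ := hK4 y
        omega
      have hne : K y ≠ 0 := by rintro h; rw [h] at hKodd; exact (by decide : ¬ Odd (0 : ℤ)) hKodd
      have : (1 : ℤ) ≤ K y ^ 2 := by
        have : K y ≤ -1 ∨ 1 ≤ K y := by omega
        rcases this with h | h <;> nlinarith
      exact_mod_cast this
    have hge : (4096 : ℝ) ≤ ∑ y, ((K y : ℝ)) ^ 2 := by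
      have := sum_le_sum fun y (_ : y ∈ (univ : Finset (Fin (6 + 6) → Bool))) => hK1 y
      rw [sum_const, card_univ, Fintype.card_fun, Fintype.card_bool, Fintype.card_fin] at this
      norm_num at this ⊢; linarith
    linarith
  · /- (2) `u_f` even: `K` even, `K ∈ {0, ±2}`, and `K = ±2` exactly where `u_f/2` is odd -/
    push Not at hO
    have huf5 := tw_level_up (j := 4) f uf huf hO
    have hKeven : ∀ y, K y = 0 ∨ K y = 2 ∨ K y = -2 := by
      intro y
      have h1 := Int.not_odd_iff_even.1 (hO y)
      rw [Int.even_iff] at h1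
      obtain ⟨q, hq⟩ := hK4 y
      have h2 := hKle y
      rw [abs_le] at h2
      omega
    have hK2iff : ∀ y, K y ≠ 0 ↔ Odd (uf y / 2) := by
      intro y
      have h1 := Int.not_odd_iff_even.1 (hO y)
      rw [Int.even_iff] at h1
      obtain ⟨q, hq⟩ := hK4 y
      rw [Int.odd_iff]
      rcases hKeven y with h | h | h <;> rw [h] at hq ⊢ <;> omega
    by_cases h5 : ∃ y₁, Odd (uf y₁ / 2)
    · -- the parity of the level-5 digit is affine: its odd set has `≥ 2048` points, each with `K² = 4`
      obtain ⟨y₁, hy₁⟩ := h5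
      have hℓ : IsDegLeFun 1 (fun y => decide (Odd (uf y / 2))) :=
        stub_walshTower stub_axParity (6 + 6) 5 1 f (fun y => uf y / 2) hf huf5 (by intro k hk hkn; omega)
      have hRM := bb_rmWeight_holds (6 + 6) 1 (fun y => decide (Odd (uf y / 2))) hℓ ⟨y₁, by simpa using hy₁⟩
      set Of := univ.filter (fun y : Fin (6 + 6) → Bool => decide (Odd (uf y / 2)) = true) with hOf
      have hOf2048 : (2048 : ℝ) ≤ #Of := by
        have h : 2048 ≤ #Of := by norm_num at hRM ⊢; omega
        exact_mod_cast h
      have hOfsq : ∀ y ∈ Of, (4 : ℝ) ≤ ((K y : ℝ)) ^ 2 := by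
        intro y hy
        have hyodd : Odd (uf y / 2) := by simpa [hOf] using (mem_filter.1 hy).2
        have hne := (hK2iff y).2 hyodd
        rcases hKeven y with h | h | h
        · exact absurd h hne
        · rw [h]; norm_num
        · rw [h]; norm_num
      have h1 : ∑ y ∈ Of, (4 : ℝ) ≤ ∑ y ∈ Of, ((K y : ℝ)) ^ 2 := sum_le_sum hOfsq
      have h2 : ∑ y ∈ Of, ((K y : ℝ)) ^ 2 ≤ ∑ y, ((K y : ℝ)) ^ 2 :=
        sum_le_sum_of_subset_of_nonneg (subset_univ _) fun y _ _ => sq_nonneg _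
      rw [sum_const, nsmul_eq_mul] at h1
      nlinarith
    · -- `K ≡ 0`: `v̂ ≡ 0`, `v ≡ 0`, contradiction with `v ≢ 0`
      push Not at h5
      have hK0 : ∀ y, K y = 0 := fun y => by
        by_contra h; exact h5 y ((hK2iff y).1 h)
      have hV0 : ∑ y, Vh y ^ 2 = 0 := sum_eq_zero fun y _ => by rw [hK8 y, hK0 y]; simp
      rw [hParsV] at hV0
      obtain ⟨x₀, hx₀⟩ := hvne
      have h1 : (1 : ℤ) ≤ ∑ x, v x ^ 2 := by
        have : v x₀ ^ 2 ≤ ∑ x, v x ^ 2 := single_le_sum (f := fun x => v x ^ 2) (fun x _ => sq_nonneg _) (mem_univ x₀)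
        have : 1 ≤ v x₀ ^ 2 := by
          have : v x₀ ≤ -1 ∨ 1 ≤ v x₀ := by omega
          rcases this with h | h <;> nlinarith
        linarith
      have : (1 : ℝ) ≤ ((∑ x, v x ^ 2 : ℤ) : ℝ) := by exact_mod_cast h1
      linarith

/-- **No type-O side with base set `960` at `Φ ≥ 930/1024`**, packaged without the partner's Ax-level data.  NOT summit progress. [this work] -/
theorem to19_typeO_E960_ge930_false' (f g : (Fin (6 + 6) → Bool) → Bool) (hf : IsDegLeFun 3 f) (hg : IsDegLeFun 3 g)
    (u : (Fin (6 + 6) → Bool) → ℤ) (hu : ∀ x, W (fun y => signOf (g y)) x = (2 : ℝ) ^ 4 * (u x : ℝ))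
    (hodd : ∃ x, Odd (u x)) (hE : #(univ.filter fun x : Fin (6 + 6) → Bool => (Odd (u x / 2) ↔ Odd (u x / 2 / 2))) = 960)
    (hΦ : (930 / 1024 : ℝ) ≤ forrelation f g) : False := by
  obtain ⟨uf, huf⟩ := tw_base (n := 6 + 6) f hf 4 (by norm_num)
  exact to19_typeO_E960_ge930_false f g hf hg u hu hodd hE hΦ uf huf

end Summit.QuantumAdvantage.QuantumAdvantage.Theorems.CubicForrelation.NearExactIsExact

end
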